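import Mathlib
import Literature.Computability.AlgebraicComplexity.MatrixMultiplicationExponent
import Literature.RingTheory.MvPolynomial.MultigradedHilbertFunction
import Summits.MatrixMultiplication.MatrixMultiplication.Theorems.FidelityWitnessesFidelityGapThreeSeventeenPunctualDefs

/-!
# `FidelityWitnesses.FidelityGapThreeSeventeen` (stmt-MatrixMultiplication-4958), line
# `punctual-saturation`: stub JM — a candidate with a sticky ideal is no limit of ideals of points

Registered stub `stub_sticky_not_slip` of the checked skeleton
`Cruxes/FidelityGapThreeSeventeen/Lines/punctual-saturation.lean`, proved against the shared
vocabulary `Theorems/FidelityWitnessesFidelityGapThreeSeventeenPunctualDefs.lean`: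
`∀ I J, IsCandidate I → IsTrihomog J → I < J → J ≤ satur I → Sticky I J → ¬ IsSlipLimit I`
(Jelisiejew–Mańdziuk, *Limits of saturated ideals*, arXiv:2210.13579, p. 4 and the proof of
Thm 3.4, in the sequential language of the line).

Proof. Let `Γ` be a Slip witness of `I`.
* `I(Γ k) = Ideal.span (⋃ D, I(Γ k)_D)`, the ideal generated by the multihomogeneous forms vanishing
  at the `17` points of `Γ k`, is trihomogeneous and its pieces are the vanishing pieces
  (`piece_ptIdeal`); in general position it has the Hilbert function of `I` (`hdim_ptIdeal`) and
  the sequence converges to `I`, so stickiness gives `k₀` and `J' ⊇ I(Γ k₀)` with the Hilbert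
  function of `J`.
* The saturation gap is bounded (`exists_gap_bound`): `I^{sat} = (I : S₊ᴺ)` (Noetherian
  stabilisation), so `S₊ᴺ J ⊆ I`; Artin–Rees gives `S₊ⁿ ∩ J ⊆ S₊ᴺ J` for `n = N + k`; and a
  form all of whose slot-degrees are `≥ n` lies in `S₊ⁿ` (`mem_irrel_pow_of_mem_SD`). Hence
  `J_D = I_D` for `D ≥ (n,n,n)`.
* General position in degree `(1,1,1)` makes the evaluation `S₁₁₁ → ℂ¹⁷` onto (`dim S₁₁₁ ≥ 17`),
  so every point `ρ` has a `(1,1,1)`-form `u` with `u(ρ) ≠ 0` (`exists_aeval_ne_zero`).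
* Some degree `D₁` has `dim I_{D₁} < dim J_{D₁} = dim J'_{D₁}` (`I < J`, components), so a form
  `g ∈ J'_{D₁}` has `g(ρ) ≠ 0` for some point `ρ` of `Γ k₀`. Then `g uⁿ ∈ J'_D`,
  `D = D₁ + n(1,1,1)`, does not vanish at `ρ`; but `dim J'_D = dim J_D = dim I_D = dim I(Γ k₀)_D`
  and `I(Γ k₀)_D ⊆ J'_D` force `J'_D = I(Γ k₀)_D`, which vanishes at `ρ` — a contradiction.

Tree technology: `MultigradedHilbertFunction.lean` (`wpiece_mono`,
`weightedHomogeneousComponent_mem_of_mem_span`, `finite_weightedHomogeneousSubmodule_of_ne_zero`);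
Mathlib: `Ideal.exists_pow_inf_eq_pow_smul` (Artin–Rees), `monotone_stabilizes_iff_noetherian`,
`Submodule.eq_of_le_of_finrank_eq`, `LinearMap.finrank_range_add_finrank_ker`, `basisMonomials`.
-/

noncomputable section

namespace Summit.MatrixMultiplication.MatrixMultiplication.Theorems.PunctualSaturation

-- single-conjunct summit: the `Summit.<S>.<P>` prefix repeats `MatrixMultiplication` (D-0017)
set_option linter.dupNamespace false

open scoped BigOperators
open MvPolynomial

/-! ## Stub JM — helpers: the trihomogeneous ideal of a configuration -/

open Literature.RingTheory.MvPolynomial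

/-- The pieces `S_D` are finite-dimensional (positive grading: `wt v = e_{v.1} ≠ 0`). -/
theorem finite_SD (D : Fin 3 → ℕ) : Module.Finite ℂ ↥(SD D) :=
  finite_weightedHomogeneousSubmodule_of_ne_zero wt
    (fun v h => by simpa [wt] using congrFun h v.1) D

/-- The vanishing pieces `I(Γ)_D` are finite-dimensional. (Both finiteness facts are used through
`haveI`, not registered as instances.) -/
theorem finite_vanishPiece (γ : Config) (D : Fin 3 → ℕ) :
    Module.Finite ℂ ↥(vanishPiece γ D) := by
  haveI := finite_SD D
  unfold vanishPiece
  infer_instance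

/-- Membership in the kernel of the evaluation map: vanishing at all `17` representatives. -/
theorem mem_ker_evalAt {γ : Config} {f : S} :
    f ∈ LinearMap.ker (evalAt γ) ↔ ∀ ρ, MvPolynomial.aeval (γ ρ) f = 0 := by
  simp [evalAt, funext_iff]

/-! The trihomogeneous ideal `I(Γ) = Ideal.span (⋃ D, I(Γ)_D)` of a configuration `Γ` (written out,
no new definition): generated by all multihomogeneous forms vanishing at the `17` points — the
homogeneous core of the affine vanishing ideal of the representatives. -/

/-- Elements of `I(Γ)` vanish at every representative. -/
theorem aeval_eq_zero_of_mem_ptIdeal {γ : Config} {f : S}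
    (hf : f ∈ Ideal.span (⋃ D, (vanishPiece γ D : Set S))) (ρ : Fin 17) :
    MvPolynomial.aeval (γ ρ) f = 0 := by
  have hle : Ideal.span (⋃ D, (vanishPiece γ D : Set S)) ≤
      RingHom.ker (MvPolynomial.aeval (γ ρ) : S →ₐ[ℂ] ℂ) := by
    refine Ideal.span_le.mpr fun g hg => ?_
    obtain ⟨D, hD⟩ := Set.mem_iUnion.mp hg
    exact (mem_ker_evalAt.mp hD.1) ρ
  exact hle hf

/-- `I(Γ)` is trihomogeneous (it is generated by multihomogeneous elements). -/
theorem isTrihomog_ptIdeal (γ : Config) :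
    IsTrihomog (Ideal.span (⋃ D, (vanishPiece γ D : Set S))) := by
  intro p hp D
  refine weightedHomogeneousComponent_mem_of_mem_span wt (fun g hg => ?_) hp D
  obtain ⟨E, hE⟩ := Set.mem_iUnion.mp hg
  exact ⟨E, (mem_weightedHomogeneousSubmodule ℂ wt E g).mp hE.2⟩

/-- The pieces of `I(Γ)` are exactly the vanishing pieces `I(Γ)_D`. -/
theorem piece_ptIdeal (γ : Config) (D : Fin 3 → ℕ) :
    piece (Ideal.span (⋃ D, (vanishPiece γ D : Set S))) D = vanishPiece γ D :=
  le_antisymm (fun _ hf => ⟨mem_ker_evalAt.mpr (aeval_eq_zero_of_mem_ptIdeal hf.1), hf.2⟩)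
    (fun _ hf => ⟨Ideal.subset_span (Set.mem_iUnion.mpr ⟨D, hf⟩), hf.2⟩)

/-- In general position, `I(Γ)` has the generic Hilbert function of `17` points, i.e. that of any
candidate `I`. -/
theorem hdim_ptIdeal {γ : Config} (hγ : InGeneralPosition γ) {I : Ideal S} (hI : HasGenericHF I)
    (D : Fin 3 → ℕ) : hdim (Ideal.span (⋃ D, (vanishPiece γ D : Set S))) D = hdim I D := by
  have h1 := hγ D
  have h2 := hI D
  have h3 : hdim (Ideal.span (⋃ D, (vanishPiece γ D : Set S))) D =
      Module.finrank ℂ ↥(vanishPiece γ D) := by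
    unfold hdim
    rw [piece_ptIdeal]
  omega

/-! ## `dim S₁₁₁ ≥ 17`, and no point of a configuration in general position has a zero slot -/

/-- The `(1,1,1)`-monomial `c_a a_b b_c` lies in `S₁₁₁`. -/
theorem monomial_mono111_mem_SD (a b c : Fin 3 × Fin 3) :
    (monomial (mono111 a b c) (1 : ℂ) : S) ∈ SD (fun _ => 1) := by
  rw [mem_weightedHomogeneousSubmodule]
  apply isWeightedHomogeneous_monomial
  simp only [mono111, map_add, Finsupp.weight_single, wt, one_smul]
  funext s
  fin_cases s <;> simp

/-- `(a, b) ↦ c_a a_b b_{00}` is injective on exponent vectors. -/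
theorem mono111_injective_pair :
    Function.Injective (fun ab : (Fin 3 × Fin 3) × (Fin 3 × Fin 3) =>
      mono111 ab.1 ab.2 ((0 : Fin 3), (0 : Fin 3))) := by
  rintro ⟨a, b⟩ ⟨a', b'⟩ h
  have ha := DFunLike.congr_fun h ((0 : Fin 3), a)
  have hb := DFunLike.congr_fun h ((1 : Fin 3), b)
  simp only [mono111, Finsupp.coe_add, Pi.add_apply, Finsupp.single_apply] at ha hb
  split_ifs at ha hb <;> simp_all

/-- **`dim S₁₁₁ ≥ 17`** (in fact `= 729`; the `81` distinct monomials `c_a a_b b_{00}` suffice). -/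
theorem seventeen_le_finrank_SD111 : 17 ≤ Module.finrank ℂ ↥(SD (fun _ => 1)) := by
  classical
  haveI : ∀ D, Module.Finite ℂ ↥(SD D) := finite_SD
  set F : (Fin 3 × Fin 3) × (Fin 3 × Fin 3) → S :=
    fun ab => monomial (mono111 ab.1 ab.2 ((0 : Fin 3), (0 : Fin 3))) 1 with hF
  have hli : LinearIndependent ℂ F := by
    have h := (MvPolynomial.basisMonomials Var ℂ).linearIndependent.comp _ mono111_injective_pair
    rw [MvPolynomial.coe_basisMonomials] at h
    exact h
  have hspan : Submodule.span ℂ (Set.range F) ≤ SD (fun _ => 1) := by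
    refine Submodule.span_le.mpr ?_
    rintro _ ⟨ab, rfl⟩
    exact monomial_mono111_mem_SD _ _ _
  have h1 : Module.finrank ℂ ↥(Submodule.span ℂ (Set.range F)) =
      Fintype.card ((Fin 3 × Fin 3) × (Fin 3 × Fin 3)) := finrank_span_eq_card hli
  have h2 := Submodule.finrank_mono hspan
  simp only [Fintype.card_prod, Fintype.card_fin] at h1
  omega

/-- **No point has a zero slot**: in general position every point admits a `(1,1,1)`-form not
vanishing at it (the evaluation `S₁₁₁ → ℂ¹⁷` is onto, its kernel having codimension
`min(17, dim S₁₁₁) = 17`). -/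
theorem exists_aeval_ne_zero {γ : Config} (hγ : InGeneralPosition γ) (ρ : Fin 17) :
    ∃ u ∈ SD (fun _ => 1), MvPolynomial.aeval (γ ρ) u ≠ 0 := by
  haveI : ∀ D, Module.Finite ℂ ↥(SD D) := finite_SD
  set V : Submodule ℂ S := SD (fun _ => (1 : ℕ)) with hV
  set φ : ↥V →ₗ[ℂ] (Fin 17 → ℂ) := (evalAt γ).domRestrict V with hφ
  have hker : Module.finrank ℂ ↥(LinearMap.ker φ) =
      Module.finrank ℂ ↥(vanishPiece γ (fun _ => 1)) := by
    have hmap : (LinearMap.ker φ).map V.subtype = vanishPiece γ (fun _ => 1) := by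
      rw [hφ, LinearMap.ker_domRestrict, Submodule.map_comap_subtype, inf_comm]
      rfl
    rw [← hmap, Submodule.finrank_map_subtype_eq]
  have hrn := LinearMap.finrank_range_add_finrank_ker φ
  have hgp := hγ (fun _ => 1)
  have hmin : min 17 (Module.finrank ℂ ↥(SD (fun _ => 1))) = 17 :=
    min_eq_left seventeen_le_finrank_SD111
  have hrange : Module.finrank ℂ ↥(LinearMap.range φ) = 17 := by
    rw [hker] at hrn
    rw [hmin] at hgp
    change Module.finrank ℂ ↥(LinearMap.range φ) + Module.finrank ℂ ↥(vanishPiece γ fun _ => 1) =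
      Module.finrank ℂ ↥(SD fun _ => 1) at hrn
    omega
  have htop : LinearMap.range φ = ⊤ :=
    Submodule.eq_top_of_finrank_eq (by rw [hrange, Module.finrank_fin_fun])
  obtain ⟨v, hv⟩ := LinearMap.range_eq_top.mp htop (Pi.single ρ 1)
  refine ⟨v, v.2, ?_⟩
  have h1 := congrFun hv ρ
  simp only [hφ, LinearMap.domRestrict_apply, evalAt, LinearMap.pi_apply,
    AlgHom.toLinearMap_apply, Pi.single_eq_same] at h1
  rw [h1]
  exact one_ne_zero

/-! ## The saturation gap lives in bounded degrees -/

/-- The `s`-th coordinate of the weight of an exponent vector is its slot-`s` degree. -/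
theorem weight_wt_apply (m : Var →₀ ℕ) (s : Fin 3) :
    Finsupp.weight wt m s = ∑ v ∈ m.support, if v.1 = s then m v else 0 := by
  rw [Finsupp.weight_apply, Finsupp.sum, Finset.sum_apply]
  refine Finset.sum_congr rfl fun v _ => ?_
  by_cases h : v.1 = s
  · subst h
    simp [wt]
  · simp [wt, Ne.symm h, h]

/-- Peeling off one slot-`s` variable from an exponent vector of positive slot-`s` degree. -/
theorem exists_eq_single_add {m : Var →₀ ℕ} {s : Fin 3} (h : Finsupp.weight wt m s ≠ 0) :
    ∃ ij : Fin 3 × Fin 3, ∃ m' : Var →₀ ℕ, m = Finsupp.single (s, ij) 1 + m' := by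
  rw [weight_wt_apply] at h
  obtain ⟨v, -, hne⟩ := Finset.exists_ne_zero_of_sum_ne_zero h
  by_cases hs : v.1 = s
  · rw [if_pos hs] at hne
    subst hs
    exact ⟨v.2, m - Finsupp.single v 1, (add_tsub_cancel_of_le
      (Finsupp.single_le_iff.mpr (Nat.one_le_iff_ne_zero.mpr hne))).symm⟩
  · exact absurd (if_neg hs) hne

/-- The weight of a single variable. -/
theorem weight_wt_single (v : Var) : Finsupp.weight wt (Finsupp.single v 1) = Pi.single v.1 1 := by
  rw [Finsupp.weight_single, one_smul, wt]

/-- **A monomial all of whose slot-degrees are `≥ n` lies in `S₊ⁿ`** (it is a multiple of an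
`n`-fold product of generators `c_a a_b b_c` of the irrelevant ideal). -/
theorem monomial_mem_irrel_pow (n : ℕ) :
    ∀ m : Var →₀ ℕ, (∀ s, n ≤ Finsupp.weight wt m s) → (monomial m (1 : ℂ) : S) ∈ irrel ^ n := by
  induction n with
  | zero => intro m _; simp
  | succ n ih =>
    intro m hm
    obtain ⟨a, m₁, rfl⟩ := exists_eq_single_add (m := m) (s := 0) (by have := hm 0; omega)
    obtain ⟨b, m₂, rfl⟩ := exists_eq_single_add (m := m₁) (s := 1) (by
      have := hm 1
      simp only [map_add, weight_wt_single, Pi.add_apply] at this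
      simp at this
      omega)
    obtain ⟨c, m₃, rfl⟩ := exists_eq_single_add (m := m₂) (s := 2) (by
      have := hm 2
      simp only [map_add, weight_wt_single, Pi.add_apply] at this
      simp at this
      omega)
    have hw : Finsupp.weight wt (Finsupp.single ((0 : Fin 3), a) 1 +
        (Finsupp.single ((1 : Fin 3), b) 1 + (Finsupp.single ((2 : Fin 3), c) 1 + m₃))) =
        (fun _ => 1) + Finsupp.weight wt m₃ := by
      simp only [map_add, weight_wt_single]
      funext s
      fin_cases s <;> simp
    have hm₃ : ∀ s, n ≤ Finsupp.weight wt m₃ s := fun s => by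
      have := hm s
      rw [hw, Pi.add_apply] at this
      omega
    have hprod : (monomial (Finsupp.single ((0 : Fin 3), a) 1 + (Finsupp.single ((1 : Fin 3), b) 1 +
        (Finsupp.single ((2 : Fin 3), c) 1 + m₃))) (1 : ℂ) : S) =
        (X ((0 : Fin 3), a) * X ((1 : Fin 3), b) * X ((2 : Fin 3), c)) * monomial m₃ 1 := by
      simp only [X, monomial_mul, one_mul, add_assoc]
    rw [hprod, pow_succ']
    exact Ideal.mul_mem_mul (Ideal.subset_span ⟨(a, b, c), rfl⟩) (ih m₃ hm₃)

/-- **A form all of whose slot-degrees are `≥ n` lies in `S₊ⁿ`.** -/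
theorem mem_irrel_pow_of_mem_SD {n : ℕ} {D : Fin 3 → ℕ} (hD : ∀ s, n ≤ D s) {f : S}
    (hf : f ∈ SD D) : f ∈ irrel ^ n := by
  rw [mem_weightedHomogeneousSubmodule] at hf
  rw [f.as_sum]
  refine Submodule.sum_mem _ fun m hm => ?_
  have hw : Finsupp.weight wt m = D := hf (mem_support_iff.mp hm)
  rw [show (monomial m (coeff m f) : S) = C (coeff m f) * monomial m 1 by
    rw [C_mul_monomial, mul_one]]
  exact Ideal.mul_mem_left _ _ (monomial_mem_irrel_pow n m fun s => hw ▸ hD s)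

/-- **The saturation is one colon ideal** `I^{sat} = (I : S₊ᴺ)` (the increasing chain `(I : S₊ⁿ)`
of ideals of the Noetherian ring `S` stabilises). -/
theorem exists_satur_eq_colon (I : Ideal S) :
    ∃ N : ℕ, satur I = Submodule.colon I ((irrel ^ N : Ideal S) : Set S) := by
  have hmono : Monotone fun n : ℕ => Submodule.colon I ((irrel ^ n : Ideal S) : Set S) :=
    fun n n' h => Submodule.colon_mono le_rfl (Ideal.pow_le_pow_right h)
  obtain ⟨N, hN⟩ := (monotone_stabilizes_iff_noetherian (R := S) (M := S)).mpr inferInstance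
    ⟨_, hmono⟩
  refine ⟨N, le_antisymm (iSup_le fun n => ?_)
    (le_iSup (fun n => Submodule.colon I ((irrel ^ n : Ideal S) : Set S)) N)⟩
  rcases le_total n N with h | h
  · exact hmono h
  · exact (hN n h).symm.le

/-- **The saturation gap is bounded**: if `J ⊆ I^{sat}` then `J_D ⊆ I_D` for every multidegree `D`
with all coordinates `≥ n` (`S₊ᴺ J ⊆ I`; Artin–Rees `S₊^{N+k} ∩ J ⊆ S₊ᴺ J`; `S_D ⊆ S₊^{N+k}`). -/
theorem exists_gap_bound {I J : Ideal S} (hJ : J ≤ satur I) :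
    ∃ n : ℕ, ∀ D : Fin 3 → ℕ, (∀ s, n ≤ D s) → ∀ f ∈ J, f ∈ SD D → f ∈ I := by
  obtain ⟨N, hN⟩ := exists_satur_eq_colon I
  have hmul : irrel ^ N * J ≤ I := by
    rw [Ideal.mul_le]
    intro r hr g hg
    have hg' : g ∈ Submodule.colon I ((irrel ^ N : Ideal S) : Set S) := hN ▸ hJ hg
    have h1 := Submodule.mem_colon.mp hg' r hr
    rwa [smul_eq_mul, mul_comm] at h1
  obtain ⟨k, hk⟩ := Ideal.exists_pow_inf_eq_pow_smul irrel (J : Submodule S S)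
  refine ⟨N + k, fun D hD f hfJ hfD => ?_⟩
  have hf2 : f ∈ irrel ^ (N + k) • (⊤ : Submodule S S) ⊓ J := by
    refine ⟨?_, hfJ⟩
    rw [Ideal.smul_eq_mul, Ideal.mul_top]
    exact mem_irrel_pow_of_mem_SD hD hfD
  rw [hk (N + k) (by omega), Nat.add_sub_cancel] at hf2
  have h3 : irrel ^ N • (irrel ^ k • (⊤ : Submodule S S) ⊓ J) ≤ irrel ^ N * J := by
    rw [← Ideal.smul_eq_mul]
    exact Submodule.smul_mono le_rfl inf_le_right
  exact hmul (h3 hf2)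

/-! ## The stub -/

/-- An element lies in an ideal as soon as all its multihomogeneous components do (it is the finite
sum of its components). -/
theorem mem_of_forall_component_mem {I : Ideal S} {f : S}
    (h : ∀ D, weightedHomogeneousComponent wt D f ∈ I) : f ∈ I := by
  classical
  rw [← sum_weightedHomogeneousComponent wt f,
    finsum_eq_sum _ (weightedHomogeneousComponent_finsupp f)]
  exact Submodule.sum_mem _ fun D _ => h D

/-- **Stub JM — a candidate with a sticky ideal is not a limit of ideals of points**
(Jelisiejew–Mańdziuk, *Limits of saturated ideals*, arXiv:2210.13579, p. 4 and the proof of Thm 3.4,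
in the sequential language of `PunctualDefs`; registered stub `stub_sticky_not_slip` of
stmt-MatrixMultiplication-4958, line `punctual-saturation`). See the module docstring for the
proof. -/
theorem stub_sticky_not_slip :
    ∀ I J : Ideal S, IsCandidate I → IsTrihomog J → I < J → J ≤ satur I → Sticky I J →
      ¬ IsSlipLimit I := by
  classical
  haveI : ∀ D, Module.Finite ℂ ↥(SD D) := finite_SD
  haveI : ∀ γ D, Module.Finite ℂ ↥(vanishPiece γ D) := finite_vanishPiece
  intro I J hC hJ hlt hJs hst hslip
  obtain ⟨-, hHF, -⟩ := hC
  obtain ⟨Γ, hgp, hconv⟩ := hslip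
  -- stickiness along the ideals of the configurations
  obtain ⟨k₀, J', -, hJ'le, hJ'dim⟩ :=
    hst (fun k => Ideal.span (⋃ D, (vanishPiece (Γ k) D : Set S)))
    (fun k => ⟨isTrihomog_ptIdeal (Γ k), fun D => hdim_ptIdeal (hgp k) hHF D⟩)
    (fun D f hf => by
      obtain ⟨fseq, hmem, hlim⟩ := hconv D f hf
      exact ⟨fseq, fun k => (piece_ptIdeal (Γ k) D).ge (hmem k), hlim⟩)
  -- a degree `D₁` where `J` is strictly bigger than `I`
  obtain ⟨D₁, hD₁⟩ : ∃ D₁, hdim I D₁ < hdim J D₁ := by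
    obtain ⟨f, hfJ, hfI⟩ := SetLike.exists_of_lt hlt
    obtain ⟨D₁, hD₁⟩ : ∃ D₁, weightedHomogeneousComponent wt D₁ f ∉ I := by
      by_contra hall
      push Not at hall
      exact hfI (mem_of_forall_component_mem hall)
    refine ⟨D₁, Submodule.finrank_lt_finrank_of_lt (lt_of_le_of_ne (wpiece_mono wt hlt.le D₁) ?_)⟩
    intro heq
    have hg : weightedHomogeneousComponent wt D₁ f ∈ piece J D₁ :=
      ⟨hJ f hfJ D₁, weightedHomogeneousComponent_mem wt f D₁⟩
    rw [← heq] at hg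
    exact hD₁ hg.1
  -- `J'` has a `D₁`-form `g` not vanishing at some point `ρ` of `Γ k₀`
  obtain ⟨g, hgJ', hgD₁, ρ, hgρ⟩ :
      ∃ g ∈ J', g ∈ SD D₁ ∧ ∃ ρ, MvPolynomial.aeval (Γ k₀ ρ) g ≠ 0 := by
    by_contra hnone
    push Not at hnone
    have hle : piece J' D₁ ≤ vanishPiece (Γ k₀) D₁ :=
      fun g hg => ⟨mem_ker_evalAt.mpr (hnone g hg.1 hg.2), hg.2⟩
    have h1 := Submodule.finrank_mono hle
    have h2 : Module.finrank ℂ ↥(vanishPiece (Γ k₀) D₁) = hdim I D₁ := by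
      rw [← piece_ptIdeal]; exact hdim_ptIdeal (hgp k₀) hHF D₁
    have h3 := hJ'dim D₁
    unfold hdim at h2 h3 hD₁
    omega
  -- a `(1,1,1)`-form `u` with `u(ρ) ≠ 0`, the gap bound `n`, and `h = g uⁿ` in degree `D`
  obtain ⟨u, hu, huρ⟩ := exists_aeval_ne_zero (hgp k₀) ρ
  obtain ⟨n, hn⟩ := exists_gap_bound hJs
  set D : Fin 3 → ℕ := D₁ + n • (fun _ => 1) with hD
  have hDn : ∀ s, n ≤ D s := fun s => by simp [hD]
  have hh_mem : g * u ^ n ∈ piece J' D := by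
    refine Submodule.mem_inf.mpr ⟨J'.mul_mem_right _ hgJ', ?_⟩
    rw [mem_weightedHomogeneousSubmodule] at hgD₁ hu
    exact (mem_weightedHomogeneousSubmodule ℂ wt D (g * u ^ n)).mpr (hgD₁.mul (hu.pow n))
  have hh_ne : MvPolynomial.aeval (Γ k₀ ρ) (g * u ^ n) ≠ 0 := by
    rw [map_mul, map_pow]
    exact mul_ne_zero hgρ (pow_ne_zero _ huρ)
  -- in degree `D` the pieces of `I`, `J`, `J'` and `I(Γ k₀)` all agree
  have hJI : piece J D = piece I D :=
    le_antisymm (fun f hf => ⟨hn D hDn f hf.1 hf.2, hf.2⟩) (wpiece_mono wt hlt.le D)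
  have hle : vanishPiece (Γ k₀) D ≤ piece J' D := by
    rw [← piece_ptIdeal]; exact wpiece_mono wt hJ'le D
  have heq : vanishPiece (Γ k₀) D = piece J' D := by
    apply Submodule.eq_of_le_of_finrank_eq hle
    have h1 : Module.finrank ℂ ↥(vanishPiece (Γ k₀) D) = hdim I D := by
      rw [← piece_ptIdeal]; exact hdim_ptIdeal (hgp k₀) hHF D
    have h2 : hdim J' D = hdim J D := hJ'dim D
    have h3 : hdim J D = hdim I D := by
      unfold hdim; rw [hJI]
    unfold hdim at h1 h2 h3
    omega
  have hmem : g * u ^ n ∈ vanishPiece (Γ k₀) D := heq ▸ hh_mem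
  exact hh_ne ((mem_ker_evalAt.mp hmem.1) ρ)

end Summit.MatrixMultiplication.MatrixMultiplication.Theorems.PunctualSaturation

end
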